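import Summits.ResolutionOfSingularities.ResolutionOfSingularities.Theorems.MarkedTransferCampaignW46MarkedSurfaces
import Summits.ResolutionOfSingularities.ResolutionOfSingularities.Theorems.MarkedTransferCampaignW46MarkedLadder
import HarnessLib

/-!
# [OURS · L1 W4.6 rung (i)⁺ SURFACES] THE NAMED MARKED RUNG CLOSED: `MarkedOrderReductionDimLE p 2` (every prime `p`)

Cell res-hironaka, LADDER-RESOLUTION rung L (D-0089), slot W4.6, rung (i) SURFACES; seat res-L1-s46-pv-1 (gen 7). res-L1-type-o1's NAMED rung
`CampaignW46.MarkedOrderReductionDimLE p d` (`…W46MarkedLadder.lean`, p562175: the host rung `HypersurfaceOrderReductionDimLE p d` = the text of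
MarkedTransfer `HypersurfaceOrderReductionDimLeThree` (stmt-ResolutionOfSingularities-16156) with `3 ↦ d` and the binder `IsEffectiveCartier I`
DROPPED) is closed at `d = 2` BY NAME from `markedOrderReduction_hostBinders` (`…W46MarkedSurfaces.lean`, p564707: marked order reduction for
every ideal sheaf on a regular surface with snc boundary, every characteristic); `d ≤ 1` follow by antitonicity, and the typer's pure-logic
nesting re-derives the host rung p557305 (`hypersurfaceOrderReductionDimLE_of_marked (markedOrderReductionDimLE_two p)`) and the Γ-free rung
at `d = 2` (`gammaFreeGlobalDimLE_of_marked …`) — not restated here (the gate's dedup rule). `--kind proof --supports` stmt-16156 `--as helper`. Everything is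
OURS; nothing here is a statement of H. Hironaka's manuscript [Hironaka2017]; no typed candidate, no FACT. AI-written; AI review is weaker than
expert review.
-/

noncomputable section

set_option linter.dupNamespace false -- mandated namespace of this single-conjunct summit

open CategoryTheory AlgebraicGeometry TopologicalSpace

namespace Summit.ResolutionOfSingularities.ResolutionOfSingularities.Theorems

namespace CampaignW46

open Literature.AlgebraicGeometry.Resolution

/-- **[OURS · W4.6 RUNG (i)⁺ SURFACES, CLOSED BY NAME] `MarkedOrderReductionDimLE p 2`**: for every prime `p`, every perfect field `k` of
characteristic `p`, every separated quasi-compact `k`-scheme `X` locally of finite type, integral and regular, of dimension `≤ 2`, EVERY ideal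
sheaf `I ≠ ⊥`, every snc boundary `E` and every `m ≥ 1`, the marked ideal `(I, E, m)` has a BGMW marked resolution — by
`markedOrderReduction_hostBinders` (whose statement is the unfolded rung). Replaces the role of «(i) SURFACES … where the host item applies» for
arbitrary marked ideals; NOT a statement of the manuscript. [cite: Kollar2007, Thm. 3.107] [cite: BierstoneGrigorievMilmanWlodarczyk2011, Def. 3.1.3] -/
theorem markedOrderReductionDimLE_two (p : ℕ) : MarkedOrderReductionDimLE p 2 :=
  markedOrderReduction_hostBinders p

/-- `d = 1` by antitonicity. [folklore] -/
theorem markedOrderReductionDimLE_one (p : ℕ) : MarkedOrderReductionDimLE p 1 :=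
  MarkedOrderReductionDimLE.of_le (by norm_num) (markedOrderReductionDimLE_two p)

/-- `d = 0` by antitonicity (the trivial slice, disclosed by the typer). [folklore] -/
theorem markedOrderReductionDimLE_zero (p : ℕ) : MarkedOrderReductionDimLE p 0 :=
  MarkedOrderReductionDimLE.of_le (by norm_num) (markedOrderReductionDimLE_two p)

end CampaignW46

end Summit.ResolutionOfSingularities.ResolutionOfSingularities.Theorems

end
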